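import Summits.ABC.ABC.Theorems.PrimePowerRadical.Negative.Orders

/-!
# Root count modulo an odd prime power

Stub `stub_card_roots_le` of the line `Sketch` (card `adelic-brjuno-summability`, crux stmt-ABC-1648,
wave 2: the metric calibration of the open stub `stub_wdc`).

We prove: for an odd prime `p`, `k ≥ 1` and `n ≥ 1`, the congruence `a ^ n ≡ 1 (mod p ^ k)` has at
most `n` solutions `a ∈ [0, p ^ k)`. (For `k = 1` this bounds the number of elements of each order in
`(ℤ/p)ˣ`; for `k ≥ 2` the Wieferich residues of level `≥ k` are the solutions of
`a ^ (2 (p - 1)) ≡ 1 (mod p ^ k)`, so there are at most `2 (p - 1)` classes of them.)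

Proof. A solution `a` reduces to an element `x := (a : ZMod (p ^ k))` with `x ^ n = 1`, hence to a unit
`u` of `ZMod (p ^ k)` with `u ^ n = 1` (`IsUnit.of_pow_eq_one`, as `n ≠ 0`); two solutions in
`[0, p ^ k)` with the same reduction are equal (`ZMod.natCast_eq_natCast_iff'`, `Nat.mod_eq_of_lt`).
So the solution set injects into `{u : (ZMod (p ^ k))ˣ | u ^ n = 1}` (`rts_card_filter_modEq_le`,
valid for every modulus), and for `p` odd the unit group `(ZMod (p ^ k))ˣ` is cyclic
(Mathlib `ZMod.isCyclic_units_of_prime_pow`), where `x ^ n = 1` has at most `n` solutions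
(Mathlib `IsCyclic.card_pow_eq_one_le`).

NOT here: the case `p = 2` (where `(ℤ/2^k)ˣ` is not cyclic for `k ≥ 3`), exact counts
(`gcd (n, φ(p^k))`), and any use of the bound — the calibration itself is the lead's `stub_wdc`.
-/

noncomputable section

-- `Summit.<Summit>.<Problem>` is the mandated summit-side namespace (CONVENTIONS §2); for the
-- single-conjunct summit `ABC` the two coincide, so the duplicate `ABC.ABC` is deliberate.
set_option linter.dupNamespace false

namespace Summit.ABC.ABC.Theorems.PrimePowerRadical.Brjuno

open Literature.NumberTheory.DiophantineGeometry UniqueFactorizationMonoid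
open Summit.ABC.ABC.Theses.IneffectiveSubspace
open Summit.ABC.ABC.Theorems.PrimePowerRadical.Negative
open scoped BigOperators

/-- A natural solution of `a ^ n ≡ 1 (mod m)` reduces to an `n`-th root of unity in `ZMod m`. -/
theorem rts_natCast_pow_eq_one {m a n : ℕ} (h : a ^ n ≡ 1 [MOD m]) :
    (a : ZMod m) ^ n = 1 := by
  have h' := (ZMod.natCast_eq_natCast_iff (a ^ n) 1 m).mpr h
  rwa [Nat.cast_pow, Nat.cast_one] at h'

/-- For any modulus `m` and exponent `n ≠ 0`, the solutions `a ∈ [0, m)` of `a ^ n ≡ 1 (mod m)` inject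
into the units `u` of `ZMod m` with `u ^ n = 1` (via `a ↦ (a : ZMod m)`, a unit since `n ≠ 0`). -/
theorem rts_card_filter_modEq_le (m : ℕ) [NeZero m] {n : ℕ} (hn : n ≠ 0) :
    ((Finset.range m).filter (fun a => a ^ n ≡ 1 [MOD m])).card ≤
      (Finset.univ.filter fun u : (ZMod m)ˣ => u ^ n = 1).card := by
  classical
  refine Finset.card_le_card_of_injOn
    (fun a : ℕ => if h : IsUnit (a : ZMod m) then h.unit else 1)
    (fun a ha => ?_) (fun a ha b hb hab => ?_)
  · rw [Finset.mem_coe, Finset.mem_filter] at ha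
    have hpow : (a : ZMod m) ^ n = 1 := rts_natCast_pow_eq_one ha.2
    have hu : IsUnit (a : ZMod m) := IsUnit.of_pow_eq_one hpow hn
    simp only [dif_pos hu, Finset.coe_filter, Set.mem_setOf_eq, Finset.mem_univ, true_and]
    ext
    rw [Units.val_pow_eq_pow_val, IsUnit.unit_spec, hpow, Units.val_one]
  · rw [Finset.mem_coe, Finset.mem_filter, Finset.mem_range] at ha hb
    have hu : IsUnit (a : ZMod m) := IsUnit.of_pow_eq_one (rts_natCast_pow_eq_one ha.2) hn
    have hv : IsUnit (b : ZMod m) := IsUnit.of_pow_eq_one (rts_natCast_pow_eq_one hb.2) hn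
    simp only [dif_pos hu, dif_pos hv] at hab
    have hval : (a : ZMod m) = (b : ZMod m) := by
      rw [← hu.unit_spec, ← hv.unit_spec, hab]
    have hmod := (ZMod.natCast_eq_natCast_iff' a b m).mp hval
    rwa [Nat.mod_eq_of_lt ha.1, Nat.mod_eq_of_lt hb.1] at hmod

/-- **Root count modulo an odd prime power.** For an odd prime `p`, `k ≥ 1` and `n ≥ 1`, the
congruence `a ^ n ≡ 1 (mod p ^ k)` has at most `n` solutions `a ∈ [0, p ^ k)`: the solutions inject
into the `n`-torsion of the cyclic group `(ZMod (p ^ k))ˣ`, which has at most `n` elements. (The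
hypothesis `1 ≤ k` is part of the registered interface; the bound also holds, trivially, for `k = 0`.) -/
theorem stub_card_roots_le {p k n : ℕ} (hp : p.Prime) (hp2 : p ≠ 2) (hk : 1 ≤ k) (hn : 1 ≤ n) :
    ((Finset.range (p ^ k)).filter (fun a => a ^ n ≡ 1 [MOD p ^ k])).card ≤ n := by
  classical
  have _hk := hk
  haveI : NeZero (p ^ k) := ⟨pow_ne_zero _ hp.ne_zero⟩
  haveI : IsCyclic (ZMod (p ^ k))ˣ := ZMod.isCyclic_units_of_prime_pow p hp hp2 k
  have hn0 : 0 < n := hn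
  exact (rts_card_filter_modEq_le (p ^ k) hn0.ne').trans (IsCyclic.card_pow_eq_one_le hn0)

end Summit.ABC.ABC.Theorems.PrimePowerRadical.Brjuno

end
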